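import Summits.BirchSwinnertonDyer.BirchSwinnertonDyer.Theorems.AdditiveKolyvaginRoadSwitchedIso
import HarnessLib

/-!
# Route `AdditiveKolyvaginRoad`, crux KS′ `LevelKolyvaginSystemsAdditive` (stmt-BirchSwinnertonDyer-21396) ∕ KPA′ (stmt-BirchSwinnertonDyer-21400):
# SWITCHED CANONICAL SPACES, part 2 — RANK LOWERING (W. Zhang Prop. 5.4 + Lemma 7.3) with E's Kummer condition above a finite set `T`
# of switched primes REPLACED by an arbitrary isotropic condition `Λ`; the case `T = {p}`
# (cell `pub/bsd-wall`, width seat `bsd-wall-akr-p2x-w3` g10; `--supports stmt-BirchSwinnertonDyer-21396`, helper; E-side engine; part 2 of 3,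
# sequel of `…SwitchedIso.lean` (p639624), followed by `…SwitchedLevelDescent.lean`)

WHY. See part 1: the landed A1 `stub_rankLoweringAdditive` (akr-p1) lowers the rank of the CANONICAL spaces `SelQP n μ`, whose local condition
above the additive `p` is E's own Kummer condition. The «FL-engine» T2 of the crux-ideate card `irred-vertex-anchor` — and every companion-structure
∕ switch-at-`p` argument on this crux chain (cards `al-even-etale-shadow`, `depleted-shadow-transfer`; memo `SWITCH-AT-P.md`) — needs the SAME rank
lowering for the Selmer structure in which E's Kummer line at the places above `p` (split in the Heegner field) is replaced by another Lagrangian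
line (the Fontaine–Laffaille line of a congruent companion form; a transported Kummer line). This file proves it once, for an ARBITRARY subgroup
`Λ ≤ H¹(K, E[p])` imposed instead of E's Kummer condition above a finite set `T` of naturals coprime to the admissible primes, under the single
hypothesis that the localisations of `Λ` above `T` are isotropic for the local Weil cup product (every Weil datum). A1 is the case «`Λ` = E's
Kummer conditions above `T`». No definition is introduced: the switched space is the term `levelSelmerSubgroupP W K p c n T μ ⊓ Λ`.

WHAT (namespace `…Theorems.AdditiveKoly`).
* §3 **`switched_rankLowering_of_localGlobal`** — the switched twin of akr-p1 g0's five-input reduction `selQP_rankLowering_of_localGlobal`: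
  from (Cheb) [for eigenclasses], (Equiv), (Line), (Trans), (IsoΛ) [`hiso_switched_of_admQ`, part 1]: every non-zero `x` of the switched level-`n`
  space of sign `μ` is killed at a NEW admissible `q`, the switched level-`(n ∪ {q})` space of sign `μ` lies in the level-`n` one with codimension
  EXACTLY one, and the `¬μ`-side is unchanged. Proof verbatim the unswitched one: the sign of `q` is forced (`loc_eq_zero_of_sign_ne_odd`), the
  one-prime step `levelSelmerSubgroupP_insert_inf_kummer_eq` AT THE RELAXED SET `T` (the places of `q` lie above no member of `n ∪ T` by
  coprimality), the kernel description, rank–nullity against the line (`ZhangInduction.finrank_inf_ker_add_one_of_line`), finiteness from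
  `finite_levelSelmerSubgroupP`.
* §4 **`switched_rankLowering`** — at a frame (`p ≥ 5`, `p ∣ N_E`, `ρ̄_{E,p}` onto, `K` imaginary quadratic with the Heegner hypothesis, `c ≠ 1`)
  the five inputs are kernel theorems: `Cheb.exists_admissible_loc_ne_zero`, `localEquiv_of_admQ`, `localLine_of_admQ`, `localTrans_of_admQ`,
  `hiso_switched_of_admQ`. (The case `T = {p}` and the iterated descent are part 3.)

HONEST FRAMING: theorems only; 0 definitions, 0 named facts, 0 `sorry`; standard axioms. Hypotheses displayed (`hΛ`, `hT`; the instance binder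
`CompactSpace` of the local absolute Galois groups is needed to state the cup products, supplied at any call site by `absoluteGaloisGroup_compactSpace`).
E-side glue; closes nothing: the parity leg of the card (E's `p`-Selmer parity + the even double switch) and everything companion-side are not
here; the crux's open content (Kolyvagin's conjecture mod `p` above the bottom at an additive `p ≥ 5`) is untouched. BSD is not proved by any of this.

References: [cite: WZhang2014, Prop. 5.4, Lemma 7.3, §9 (9.1)–(9.3)] [cite: BertoliniDarmon2005, Lemma 2.6, §2.2–§2.3, Thm. 3.2]
[cite: MilneADT2006, Ch. I, Cor. 2.3, Thm. 2.8, Thm. 4.10(b)] [cite: GrossLMS1991, Prop. 9.3, 9.6] [cite: PoonenRains2012, Prop. 4.10].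
-/

-- single-conjunct summit: `Summit.BirchSwinnertonDyer.BirchSwinnertonDyer.…` repeats the name by design
set_option linter.dupNamespace false

noncomputable section

open scoped Classical

namespace Summit.BirchSwinnertonDyer.BirchSwinnertonDyer.Theorems.AdditiveKoly

open CategoryTheory WeierstrassCurve Field Function NumberField IsDedekindDomain
open Literature.NumberTheory.EllipticCurves Literature.NumberTheory.EllipticCurves.ModularForms
  Literature.NumberTheory.EllipticCurves.Rank1Residual Literature.NumberTheory.GaloisRepresentations Module
open Literature.NumberTheory.GaloisRepresentations.DiscreteGaloisModule (mu MuCarrier)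
open Literature.NumberTheory.GaloisCohomology
open Summit.BirchSwinnertonDyer.Rank1Residual.X11b.Three.Koly.Method2
open scoped ContRepresentation

variable (W : WeierstrassCurve ℚ) (K : Type) [Field K] [NumberField K] (p : ℕ) (c : K ≃ₐ[ℚ] K)

/-! ## §3 Rank lowering for the switched spaces from (Cheb) + (Equiv) + (Line) + (Trans) + (IsoΛ) -/

section RankLowering

variable [W.IsElliptic] [W.IsGloballyMinimal] [Fact p.Prime] [Module (ZMod p) (Vp W K p)]

/-- **RANK LOWERING for the SWITCHED canonical spaces `levelSelmerSubgroupP n T μ ⊓ Λ`, from five local–global inputs** — the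
switched twin of akr-p1 g0's `selQP_rankLowering_of_localGlobal` (W. Zhang Prop. 5.4 + Lemma 7.3). Data: a finite set `T` of naturals
coprime to every Bertolini–Darmon admissible prime (the SWITCHED primes: there E's Kummer condition is dropped) and ANY subgroup
`Λ ≤ H¹(K, E[p])` (the condition imposed instead). Inputs: (Cheb) a non-zero `ν`-eigenclass of complex conjugation is detected at the place
of an admissible prime outside any finite set; (Equiv) complex conjugation acts on `H¹(K_q, E[p])` by a scalar sign; (Line) the Kummer
localisations at `q` are multiples of one class; (Trans) Kummer ∩ toric = 0 at `q`; (IsoΛ) the localisations at `q` of two classes of the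
switched space relaxed at `q` are proportional (`hiso_switched_of_admQ`). Conclusion: every non-zero `x` of the switched level-`n` space of sign
`μ` is killed at some new admissible `q`, the switched level-`(n ∪ {q})` space of sign `μ` sits inside the level-`n` one with codimension
EXACTLY one, and the `¬μ`-side is unchanged. Proof verbatim the unswitched one (sign forcing, the one-prime step
`levelSelmerSubgroupP_insert_inf_kummer_eq` at the relaxed set `T`, the kernel description, rank–nullity against the line).
[cite: WZhang2014, Prop. 5.4, Lemma 7.3, §9 (9.1)–(9.3)] [cite: BertoliniDarmon2005, Lemma 2.6, Thm. 3.2] -/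
theorem switched_rankLowering_of_localGlobal (hp : Odd p) (T : Set ℕ) (hTfin : T.Finite)
    (hT : ∀ t ∈ T, ∀ q : AdmQ W K p, Nat.Coprime (q : ℕ) t) (Λ : AddSubgroup (Vp W K p))
    -- (Cheb) Čebotarev with the sign rule, for eigenclasses
    (hcheb : ∀ (ν : Bool) (x : Vp W K p), conjAct W c ((p ^ 1 : ℕ) : ℤ) x = sgnP ν • x → x ≠ 0 →
      ∀ B₀ : Finset (AdmQ W K p), ∃ q : AdmQ W K p, q ∉ B₀ ∧ ∃ v : HeightOneSpectrum (𝓞 K),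
        ((q : ℕ) : 𝓞 K) ∈ v.asIdeal ∧ (W.baseChange K).torsionLocMap (v.adicCompletion K) ((p ^ 1 : ℕ) : ℤ) x ≠ 0)
    -- (Equiv) complex conjugation acts on H¹(K_q, E[p]) by the scalar sign of q, equivariantly
    (hequiv : ∀ q : AdmQ W K p, ∃ s : Bool, ∀ v : HeightOneSpectrum (𝓞 K),
      ((q : ℕ) : 𝓞 K) ∈ v.asIdeal → ∀ z : Vp W K p,
        (W.baseChange K).torsionLocMap (v.adicCompletion K) ((p ^ 1 : ℕ) : ℤ) (conjAct W c ((p ^ 1 : ℕ) : ℤ) z) =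
          sgnP s • (W.baseChange K).torsionLocMap (v.adicCompletion K) ((p ^ 1 : ℕ) : ℤ) z)
    -- (Line) the Kummer image at q is a line
    (hline : ∀ (q : AdmQ W K p) (v : HeightOneSpectrum (𝓞 K)), ((q : ℕ) : 𝓞 K) ∈ v.asIdeal →
      ∃ ℓ, ∀ y ∈ selmerLocalKer (W.baseChange K) (v.adicCompletion K) ((p ^ 1 : ℕ) : ℤ),
        ∃ a : ℤ, (W.baseChange K).torsionLocMap (v.adicCompletion K) ((p ^ 1 : ℕ) : ℤ) y = a • ℓ)
    -- (Trans) Kummer ∩ toric = 0 at q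
    (htrans : ∀ (q : AdmQ W K p) (v : HeightOneSpectrum (𝓞 K)), ((q : ℕ) : 𝓞 K) ∈ v.asIdeal →
      ∀ y z : Vp W K p, y ∈ selmerLocalKer (W.baseChange K) (v.adicCompletion K) ((p ^ 1 : ℕ) : ℤ) →
        z ∈ toricLocalKer (W.baseChange K) (v.adicCompletion K) ((p ^ 1 : ℕ) : ℤ) →
        (∃ a : ℤ, (W.baseChange K).torsionLocMap (v.adicCompletion K) ((p ^ 1 : ℕ) : ℤ) z =
          a • (W.baseChange K).torsionLocMap (v.adicCompletion K) ((p ^ 1 : ℕ) : ℤ) y) →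
        (W.baseChange K).torsionLocMap (v.adicCompletion K) ((p ^ 1 : ℕ) : ℤ) z = 0)
    -- (IsoΛ) Poitou–Tate isotropy of the image of the switched space relaxed at q
    (hiso : ∀ (n : Finset (AdmQ W K p)) (q : AdmQ W K p) (μ : Bool),
      q ∉ n → ∀ v : HeightOneSpectrum (𝓞 K), ((q : ℕ) : 𝓞 K) ∈ v.asIdeal →
      ∀ y ∈ levelSelmerSubgroupP W K p c (insert (q : ℕ) (n.image Subtype.val)) (insert (q : ℕ) T) μ ⊓ Λ,
      ∀ z ∈ levelSelmerSubgroupP W K p c (insert (q : ℕ) (n.image Subtype.val)) (insert (q : ℕ) T) μ ⊓ Λ,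
        (W.baseChange K).torsionLocMap (v.adicCompletion K) ((p ^ 1 : ℕ) : ℤ) z ≠ 0 →
        ∃ a : ℤ, (W.baseChange K).torsionLocMap (v.adicCompletion K) ((p ^ 1 : ℕ) : ℤ) y =
          a • (W.baseChange K).torsionLocMap (v.adicCompletion K) ((p ^ 1 : ℕ) : ℤ) z) :
    ∀ (n : Finset (AdmQ W K p)) (μ : Bool) (x : Vp W K p),
      x ∈ AddSubgroup.toZModSubmodule p (levelSelmerSubgroupP W K p c (n.image Subtype.val) T μ ⊓ Λ) → x ≠ 0 →
      ∃ q : AdmQ W K p, q ∉ n ∧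
        x ∉ AddSubgroup.toZModSubmodule p
          (levelSelmerSubgroupP W K p c ((insert q n).image Subtype.val) T μ ⊓ Λ) ∧
        AddSubgroup.toZModSubmodule p (levelSelmerSubgroupP W K p c ((insert q n).image Subtype.val) T μ ⊓ Λ) ≤
          AddSubgroup.toZModSubmodule p (levelSelmerSubgroupP W K p c (n.image Subtype.val) T μ ⊓ Λ) ∧
        finrank (ZMod p)
            (AddSubgroup.toZModSubmodule p (levelSelmerSubgroupP W K p c ((insert q n).image Subtype.val) T μ ⊓ Λ)) + 1 =
          finrank (ZMod p) (AddSubgroup.toZModSubmodule p (levelSelmerSubgroupP W K p c (n.image Subtype.val) T μ ⊓ Λ)) ∧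
        AddSubgroup.toZModSubmodule p (levelSelmerSubgroupP W K p c ((insert q n).image Subtype.val) T (!μ) ⊓ Λ) =
          AddSubgroup.toZModSubmodule p (levelSelmerSubgroupP W K p c (n.image Subtype.val) T (!μ) ⊓ Λ) := by
  intro n μ x hx hx0
  -- membership in the switched spaces, unfolded to the level space and `Λ`
  have hmemZ : ∀ (m : Finset ℕ) (S : Set ℕ) (ν : Bool) (y : Vp W K p),
      y ∈ AddSubgroup.toZModSubmodule p (levelSelmerSubgroupP W K p c m S ν ⊓ Λ) ↔
        y ∈ levelSelmerSubgroupP W K p c m S ν ∧ y ∈ Λ := fun m S ν y ↦ by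
    rw [AddSubgroup.mem_toZModSubmodule, AddSubgroup.mem_inf]
  have hsgn_of : ∀ (m : Finset ℕ) (S : Set ℕ) (ν : Bool) (y : Vp W K p),
      y ∈ AddSubgroup.toZModSubmodule p (levelSelmerSubgroupP W K p c m S ν ⊓ Λ) →
        conjAct W c ((p ^ 1 : ℕ) : ℤ) y = sgnP ν • y := fun m S ν y hy ↦
    ((mem_levelSelmerSubgroupP_iff W K p c _ _ ν y).mp ((hmemZ m S ν y).mp hy).1).1
  -- the sign of `x`
  have hxsgn : conjAct W c ((p ^ 1 : ℕ) : ℤ) x = sgnP μ • x := hsgn_of _ _ μ x hx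
  obtain ⟨q, hqn, v, hv, hvx⟩ := hcheb μ x hxsgn hx0 n
  set loc := (W.baseChange K).torsionLocMap (v.adicCompletion K) ((p ^ 1 : ℕ) : ℤ) with hloc
  -- `q` versus `T`: not a member, and its place lies above no member of `n ∪ T`
  have hq0 : (q : ℕ) ≠ 0 := q.2.1.ne_zero
  have hqT : (q : ℕ) ∉ T := fun h ↦ by
    have h1 := hT _ h q
    rw [Nat.coprime_self] at h1
    exact q.2.1.one_lt.ne' h1
  have hT0 : (0 : ℕ) ∉ T := fun h ↦ by
    have h1 := hT _ h q
    rw [Nat.coprime_zero_right] at h1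
    exact q.2.1.one_lt.ne' h1
  have hqn' : (q : ℕ) ∉ n.image Subtype.val := fun h ↦ by
    rw [Finset.mem_image] at h
    obtain ⟨a, ha, ha'⟩ := h
    exact hqn (by rwa [show a = q from Subtype.ext ha'] at ha)
  have hdisj : ∀ v' : HeightOneSpectrum (𝓞 K), ((q : ℕ) : 𝓞 K) ∈ v'.asIdeal →
      ∀ q' ∈ ((n.image Subtype.val : Finset ℕ) : Set ℕ) ∪ T, (q' : 𝓞 K) ∉ v'.asIdeal := by
    intro v' hv' q' hq'
    rcases hq' with hq' | hq'
    · have h := disjoint_places_of_admQ W K p n ∅ q hqn (Set.notMem_empty _) v' hv' q'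
      rw [Set.image_empty, Set.union_empty] at h
      exact h hq'
    · exact not_mem_asIdeal_of_coprime K (hT q' hq' q) v' hv'
  -- the place above the inert prime q is unique
  have hqP : (Ideal.span {((q : ℕ) : 𝓞 K)}).IsPrime := q.2.2.2.1
  have huniq : ∀ v' : HeightOneSpectrum (𝓞 K), ((q : ℕ) : 𝓞 K) ∈ v'.asIdeal → v' = v :=
    fun v' hv' ↦ placesAbove_eq_of_isPrime_span K hqP hq0 hv hv'
  -- local classes are p-torsion, `p` odd
  have hNloc : ∀ z : Vp W K p, ((p ^ 1 : ℕ) : ℤ) • loc z = 0 := fun z ↦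
    zsmul_discreteH1_torsion ((p ^ 1 : ℕ) : ℤ) (loc z)
  have hNodd : Odd (((p ^ 1 : ℕ) : ℤ)) := by
    rw [pow_one]
    exact_mod_cast hp
  -- the sign of q is forced to be μ
  obtain ⟨s, hs⟩ := hequiv q
  have hsv : ∀ z : Vp W K p, loc (conjAct W c ((p ^ 1 : ℕ) : ℤ) z) = sgnP s • loc z := hs v hv
  have hsμ : s = μ := by
    by_contra hne
    exact hvx (loc_eq_zero_of_sign_ne_odd (conjAct W c _) loc hsv hxsgn hne hNodd (hNloc x))
  -- hence loc_q kills every (¬μ)-eigenclass of the switched spaces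
  have hkill : ∀ (m : Finset ℕ) (y : Vp W K p),
      y ∈ AddSubgroup.toZModSubmodule p (levelSelmerSubgroupP W K p c m T (!μ) ⊓ Λ) → loc y = 0 :=
    fun m y hy ↦ loc_eq_zero_of_sign_ne_odd (conjAct W c _) loc hsv (hsgn_of m T (!μ) y hy)
      (by rw [hsμ]; cases μ <;> decide) hNodd (hNloc y)
  -- zero classes are Kummer and toric
  have hKumTor : ∀ y : Vp W K p, loc y = 0 →
      y ∈ selmerLocalKer (W.baseChange K) (v.adicCompletion K) ((p ^ 1 : ℕ) : ℤ) := fun y hy ↦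
    (W.baseChange K).torsionLocalKer_le_selmerLocalKer (v.adicCompletion K) _ (AddMonoidHom.mem_ker.mpr hy)
  have hOrdTor : ∀ y : Vp W K p, loc y = 0 →
      y ∈ toricLocalKer (W.baseChange K) (v.adicCompletion K) ((p ^ 1 : ℕ) : ℤ) := fun y hy ↦
    torsionLocalKer_le_toricLocalKer W K _ _ (AddMonoidHom.mem_ker.mpr hy)
  -- the one-prime step at the relaxed set `T`, in membership form at the unique place v, with `Λ` carried along
  have himage : (insert q n).image Subtype.val = insert (q : ℕ) (n.image Subtype.val) := Finset.image_insert _ _ _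
  have hstep : ∀ (ν : Bool) (y : Vp W K p),
      (y ∈ AddSubgroup.toZModSubmodule p (levelSelmerSubgroupP W K p c ((insert q n).image Subtype.val) T ν ⊓ Λ) ∧
        y ∈ selmerLocalKer (W.baseChange K) (v.adicCompletion K) ((p ^ 1 : ℕ) : ℤ)) ↔
      (y ∈ AddSubgroup.toZModSubmodule p (levelSelmerSubgroupP W K p c (n.image Subtype.val) T ν ⊓ Λ) ∧
        y ∈ toricLocalKer (W.baseChange K) (v.adicCompletion K) ((p ^ 1 : ℕ) : ℤ)) := by
    intro ν y
    rw [hmemZ, hmemZ, himage]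
    have h' := SetLike.ext_iff.mp
      (levelSelmerSubgroupP_insert_inf_kummer_eq W K p c (n.image Subtype.val) T ν hqn' hqT hdisj) y
    simp only [AddSubgroup.mem_inf, AddSubgroup.mem_iInf] at h'
    constructor
    · rintro ⟨⟨h1, hΛ⟩, h2⟩
      obtain ⟨h1', h2'⟩ := h'.mp ⟨h1, fun v' hv' ↦ by rw [huniq v' hv']; exact h2⟩
      exact ⟨⟨h1', hΛ⟩, h2' v hv⟩
    · rintro ⟨⟨h1, hΛ⟩, h2⟩
      obtain ⟨h1', h2'⟩ := h'.mpr ⟨h1, fun v' hv' ↦ by rw [huniq v' hv']; exact h2⟩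
      exact ⟨⟨h1', hΛ⟩, h2' v hv⟩
  -- unswitched conditions at the place `v` of classes of the switched spaces
  have hKum_of : ∀ (ν : Bool) (y : Vp W K p),
      y ∈ AddSubgroup.toZModSubmodule p (levelSelmerSubgroupP W K p c (n.image Subtype.val) T ν ⊓ Λ) →
        y ∈ selmerLocalKer (W.baseChange K) (v.adicCompletion K) ((p ^ 1 : ℕ) : ℤ) := fun ν y hy ↦
    ((mem_levelSelmerSubgroupP_iff W K p c _ _ ν y).mp ((hmemZ _ T ν y).mp hy).1).2.2.1 v (hdisj v hv)
  have hTor_of : ∀ (ν : Bool) (y : Vp W K p),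
      y ∈ AddSubgroup.toZModSubmodule p (levelSelmerSubgroupP W K p c ((insert q n).image Subtype.val) T ν ⊓ Λ) →
        y ∈ toricLocalKer (W.baseChange K) (v.adicCompletion K) ((p ^ 1 : ℕ) : ℤ) := fun ν y hy ↦ by
    rw [himage] at hy
    exact ((mem_levelSelmerSubgroupP_iff W K p c _ _ ν y).mp ((hmemZ _ T ν y).mp hy).1).2.2.2 q
      ⟨Finset.mem_insert_self _ _, hqT⟩ v hv
  -- the relaxed switched space at q contains both levels
  have hrel_of_n : ∀ (ν : Bool) (y : Vp W K p),
      y ∈ AddSubgroup.toZModSubmodule p (levelSelmerSubgroupP W K p c (n.image Subtype.val) T ν ⊓ Λ) →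
        y ∈ levelSelmerSubgroupP W K p c (insert (q : ℕ) (n.image Subtype.val)) (insert (q : ℕ) T) ν ⊓ Λ :=
    fun ν y hy ↦ by
      obtain ⟨h1, h2⟩ := (hmemZ _ T ν y).mp hy
      exact AddSubgroup.mem_inf.mpr ⟨levelSelmerSubgroupP_le_insert_of_mem W K p c _ (Set.subset_insert _ _)
        (Set.mem_insert _ _) ν h1, h2⟩
  have hrel_of_insert : ∀ (ν : Bool) (y : Vp W K p),
      y ∈ AddSubgroup.toZModSubmodule p (levelSelmerSubgroupP W K p c ((insert q n).image Subtype.val) T ν ⊓ Λ) →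
        y ∈ levelSelmerSubgroupP W K p c (insert (q : ℕ) (n.image Subtype.val)) (insert (q : ℕ) T) ν ⊓ Λ :=
    fun ν y hy ↦ by
      rw [himage] at hy
      obtain ⟨h1, h2⟩ := (hmemZ _ T ν y).mp hy
      exact AddSubgroup.mem_inf.mpr ⟨levelSelmerSubgroupP_mono_relaxed W K p c _ (Set.subset_insert _ _) ν h1, h2⟩
  -- the KERNEL DESCRIPTION (Zhang Prop 5.4) on the μ-side
  have hker : ∀ y : Vp W K p,
      y ∈ AddSubgroup.toZModSubmodule p (levelSelmerSubgroupP W K p c ((insert q n).image Subtype.val) T μ ⊓ Λ) ↔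
        (y ∈ AddSubgroup.toZModSubmodule p (levelSelmerSubgroupP W K p c (n.image Subtype.val) T μ ⊓ Λ) ∧
          loc y = 0) := by
    intro y
    constructor
    · intro hy
      have hy0 : loc y = 0 :=
        htrans q v hv x y (hKum_of μ x hx) (hTor_of μ y hy)
          (hiso n q μ hqn v hv y (hrel_of_insert μ y hy) x (hrel_of_n μ x hx) hvx)
      exact ⟨((hstep μ y).mp ⟨hy, hKumTor y hy0⟩).1, hy0⟩
    · rintro ⟨hy, hy0⟩
      exact ((hstep μ y).mpr ⟨hy, hOrdTor y hy0⟩).1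
  -- codimension exactly one: rank–nullity against the line (Line), over ZMod p
  haveI : Module (ZMod p) (discreteH1 (Field.absoluteGaloisGroup (v.adicCompletion K))
      (AddSubgroup.torsionBy (localPoints (W.baseChange K) (v.adicCompletion K)) ((p ^ 1 : ℕ) : ℤ))) :=
    AddCommGroup.zmodModule (fun z ↦ by
      have h := zsmul_discreteH1_torsion ((p ^ 1 : ℕ) : ℤ) z
      rw [← natCast_zsmul]
      convert h using 2
      push_cast
      ring)
  set locZ := loc.toZModLinearMap p with hlocZ
  have hlocZ_apply : ∀ y : Vp W K p, locZ y = loc y := fun _ ↦ rfl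
  obtain ⟨ℓ, hℓ⟩ := hline q v hv
  set V := AddSubgroup.toZModSubmodule p (levelSelmerSubgroupP W K p c (n.image Subtype.val) T μ ⊓ Λ) with hV
  haveI : FiniteDimensional (ZMod p) V := by
    have hfin : Finite (levelSelmerSubgroupP W K p c (n.image Subtype.val) T μ) := by
      refine finite_levelSelmerSubgroupP W K p c _ _ hTfin ?_ μ
      rintro (h | h)
      · rw [Finset.mem_coe, Finset.mem_image] at h
        obtain ⟨q', -, hq'⟩ := h
        exact AdmQ.ne_zero W K p q' hq'
      · exact hT0 h
    have hfin' : Finite (levelSelmerSubgroupP W K p c (n.image Subtype.val) T μ ⊓ Λ : AddSubgroup (Vp W K p)) :=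
      Finite.of_injective (fun y ↦ (⟨y.1, (AddSubgroup.mem_inf.mp y.2).1⟩ :
          levelSelmerSubgroupP W K p c (n.image Subtype.val) T μ))
        (fun y y' h ↦ Subtype.ext (by simpa using congrArg Subtype.val h))
    have hfinV : Finite V := by
      rw [hV]
      exact Finite.of_equiv _ (Equiv.setCongr (AddSubgroup.coe_toZModSubmodule p _).symm)
    exact Module.Finite.of_finite
  haveI : FiniteDimensional (ZMod p) (Submodule.span (ZMod p) ({ℓ} : Set _)) :=
    FiniteDimensional.span_of_finite (ZMod p) (Set.finite_singleton ℓ)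
  have hfr : finrank (ZMod p) ↥(V ⊓ LinearMap.ker locZ) + 1 = finrank (ZMod p) V := by
    refine Summit.BirchSwinnertonDyer.Rank1Residual.X11b.Three.Koly.ZhangInduction.finrank_inf_ker_add_one_of_line
      V locZ (Submodule.span (ZMod p) {ℓ})
      ((finrank_span_le_card _).trans (le_of_eq (by rw [Set.toFinset_card, Set.card_singleton]))) ?_
      ⟨x, hx, by rw [hlocZ_apply]; exact hvx⟩
    intro y hy
    obtain ⟨a, ha⟩ := hℓ y (hKum_of μ y hy)
    rw [Submodule.mem_span_singleton]
    exact ⟨(a : ZMod p), by rw [hlocZ_apply, ha, Int.cast_smul_eq_zsmul]⟩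
  have heq : AddSubgroup.toZModSubmodule p
      (levelSelmerSubgroupP W K p c ((insert q n).image Subtype.val) T μ ⊓ Λ) = V ⊓ LinearMap.ker locZ := by
    ext y
    rw [Submodule.mem_inf, LinearMap.mem_ker, hlocZ_apply]
    exact hker y
  refine ⟨q, hqn, fun hxq ↦ hvx ((hker x).mp hxq).2, fun y hy ↦ ((hker y).mp hy).1, by rw [heq]; exact hfr, ?_⟩
  -- the (¬μ)-side is untouched
  ext y
  constructor
  · intro hy
    exact ((hstep (!μ) y).mp ⟨hy, hKumTor y (hkill _ y hy)⟩).1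
  · intro hy
    exact ((hstep (!μ) y).mpr ⟨hy, hOrdTor y (hkill _ y hy)⟩).1

end RankLowering

/-! ## §4 The switched rank lowering at a frame: the five inputs discharged -/

section Frame

variable [W.IsElliptic] [W.IsGloballyMinimal] [Fact p.Prime] [Module (ZMod p) (Vp W K p)]
  [∀ v : Place K, CompactSpace (absoluteGaloisGroup (Place.Completion v))]

/-- **RANK LOWERING FOR SWITCHED CANONICAL SPACES** (W. Zhang Prop. 5.4 + Lemma 7.3 with an arbitrary isotropic condition at a finite
set of switched primes). Frame: `p ≥ 5` with `p ∣ N_E` and `ρ̄_{E,p}` onto, `K` imaginary quadratic with the Heegner hypothesis for `N_E`,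
complex conjugation `c ≠ 1`, the `ZMod p`-structure of `H¹(K, E[p])`. Data: a finite set `T` of naturals coprime to every Bertolini–Darmon
admissible prime (e.g. `T = {p}`, or the primes of `pN`) and a subgroup `Λ ≤ H¹(K, E[p])` whose localisations at the places above `T` are
isotropic for the local Weil cup product of every Weil datum on `E[p]` (`hΛ`; e.g. the pull-back of Lagrangian LINES at the two places
above the split `p` — the Fontaine–Laffaille line of a congruent companion form, the transported Kummer line of a congruent curve —, or
E's own Kummer conditions, which recovers the landed A1 `stub_rankLoweringAdditive`). Conclusion, for the SWITCHED level spaces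
`Sel^{T,Λ}_n(μ) := levelSelmerSubgroupP n T μ ⊓ Λ` (E's Kummer condition off `n ∪ T`, toric at `n`, nothing at `T`, sign `μ`, inside `Λ`):
every non-zero `x ∈ Sel^{T,Λ}_n(μ)` is killed at some NEW admissible `q`, `Sel^{T,Λ}_{n∪q}(μ) ≤ Sel^{T,Λ}_n(μ)` with codimension EXACTLY one, and
`Sel^{T,Λ}_{n∪q}(¬μ) = Sel^{T,Λ}_n(¬μ)`. Inputs, all kernel theorems: (Cheb) `Cheb.exists_admissible_loc_ne_zero` (Čebotarev with the sign,
`ρ̄` onto, `p ≥ 5`), (Equiv) `localEquiv_of_admQ`, (Line) `localLine_of_admQ`, (Trans) `localTrans_of_admQ`, (IsoΛ)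
`hiso_switched_of_admQ` (Tate reciprocity for the totally complex `K`). The E-side engine «FL-engine ∕ T2» of the crux-ideate card
`irred-vertex-anchor` and of every companion-structure ∕ switch-at-`p` argument at an additive `p`, unconditionally.
[cite: WZhang2014, Prop. 5.4, Lemma 7.3, §9 (9.1)–(9.3)] [cite: BertoliniDarmon2005, Lemma 2.6, Thm. 3.2] [cite: MilneADT2006, Ch. I,
Thm. 4.10(b)] [cite: GrossLMS1991, Prop. 9.3, 9.6] -/
theorem switched_rankLowering (h5 : 5 ≤ p) (hpN : p ∣ W.conductorNorm ℤ) (hsurj : W.HasSurjectiveModNGaloisRep p)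
    (hK : IsImaginaryQuadratic K) (hH : SatisfiesHeegnerHypothesis (W.conductorNorm ℤ) K) (hc1 : c ≠ 1)
    (T : Set ℕ) (hTfin : T.Finite) (hT : ∀ t ∈ T, ∀ q : AdmQ W K p, Nat.Coprime (q : ℕ) t) (Λ : AddSubgroup (Vp W K p))
    (hΛ : ∀ (e : geomTorsion (W.baseChange K) ((p ^ 1 : ℕ) : ℤ) → geomTorsion (W.baseChange K) ((p ^ 1 : ℕ) : ℤ) →
        AlgebraicClosure K)
      (hμ : ∀ S T, e S T ^ (p ^ 1) = 1)
      (hadd₁ : ∀ S₁ S₂ T, e (S₁ + S₂) T = e S₁ T * e S₂ T)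
      (hadd₂ : ∀ S T₁ T₂, e S (T₁ + T₂) = e S T₁ * e S T₂)
      (hgal : ∀ (σ : absoluteGaloisGroup K) (S T : geomTorsion (W.baseChange K) ((p ^ 1 : ℕ) : ℤ)),
        σ • e S T = e (σ • S) (σ • T)),
      ∀ t ∈ T, ∀ w : HeightOneSpectrum (𝓞 K), (t : 𝓞 K) ∈ w.asIdeal → ∀ y ∈ Λ, ∀ z ∈ Λ,
        (weilContPairingLocal (W.baseChange K) (p ^ 1) e hμ hadd₁ hadd₂ hgal (Sum.inr w)).cupProduct
          (galoisCohomology.localization ((W.baseChange K).torsionGaloisModule ((p ^ 1 : ℕ) : ℤ)) (Sum.inr w) 1 y)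
          (galoisCohomology.localization ((W.baseChange K).torsionGaloisModule ((p ^ 1 : ℕ) : ℤ)) (Sum.inr w) 1 z)
          = 0) :
    ∀ (n : Finset (AdmQ W K p)) (μ : Bool) (x : Vp W K p),
      x ∈ AddSubgroup.toZModSubmodule p (levelSelmerSubgroupP W K p c (n.image Subtype.val) T μ ⊓ Λ) → x ≠ 0 →
      ∃ q : AdmQ W K p, q ∉ n ∧
        x ∉ AddSubgroup.toZModSubmodule p
          (levelSelmerSubgroupP W K p c ((insert q n).image Subtype.val) T μ ⊓ Λ) ∧
        AddSubgroup.toZModSubmodule p (levelSelmerSubgroupP W K p c ((insert q n).image Subtype.val) T μ ⊓ Λ) ≤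
          AddSubgroup.toZModSubmodule p (levelSelmerSubgroupP W K p c (n.image Subtype.val) T μ ⊓ Λ) ∧
        finrank (ZMod p)
            (AddSubgroup.toZModSubmodule p (levelSelmerSubgroupP W K p c ((insert q n).image Subtype.val) T μ ⊓ Λ)) + 1 =
          finrank (ZMod p) (AddSubgroup.toZModSubmodule p (levelSelmerSubgroupP W K p c (n.image Subtype.val) T μ ⊓ Λ)) ∧
        AddSubgroup.toZModSubmodule p (levelSelmerSubgroupP W K p c ((insert q n).image Subtype.val) T (!μ) ⊓ Λ) =
          AddSubgroup.toZModSubmodule p (levelSelmerSubgroupP W K p c (n.image Subtype.val) T (!μ) ⊓ Λ) := by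
  have hp : p.Prime := Fact.out
  have hodd : Odd p := hp.odd_of_ne_two (by omega)
  refine switched_rankLowering_of_localGlobal W K p c hodd T hTfin hT Λ ?_ (localEquiv_of_admQ W K p hK.1 hc1)
    (localLine_of_admQ W K p hK.1) (localTrans_of_admQ W K p) (hiso_switched_of_admQ W K p c hK T Λ hΛ)
  -- (Cheb): Čebotarev with the sign, for any eigenclass
  intro ν x hxν hx0 B₀
  haveI : Fact (Nat.Prime (p ^ 1)) := ⟨by rw [pow_one]; exact hp⟩
  have h5' : 5 ≤ p ^ 1 := by rw [pow_one]; exact h5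
  have hpN' : p ^ 1 ∣ W.conductorNorm ℤ := by rw [pow_one]; exact hpN
  have hsurj' : W.HasSurjectiveModNGaloisRep ((p ^ 1 : ℕ) : ℤ) := by rw [Nat.pow_one]; exact hsurj
  have hν : sgnP ν = 1 ∨ sgnP ν = -1 := by cases ν <;> simp [sgnP]
  obtain ⟨q, hqB, hadm, v, hqv, hloc⟩ := Cheb.exists_admissible_loc_ne_zero W K (p := p ^ 1) h5' hK hsurj' hpN' hH
    hc1 hν hx0 hxν (B₀.image Subtype.val)
  rw [Nat.pow_one] at hadm
  exact ⟨⟨q, hadm⟩, fun hqn ↦ hqB (Finset.mem_image.mpr ⟨⟨q, hadm⟩, hqn, rfl⟩), v, hqv, fun h0 ↦ hloc h0⟩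

end Frame

end Summit.BirchSwinnertonDyer.BirchSwinnertonDyer.Theorems.AdditiveKoly

end
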